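import Summits.SmoothPoincare4.SmoothPoincare4.Theorems.ConvexBisectionAcyclicBisectionExistsMixedIndexLift
import Summits.SmoothPoincare4.SmoothPoincare4.Theorems.ConvexBisectionAcyclicBisectionExistsStabilisationData
import Literature.Topology.FourManifolds.OrientedConnectedSumExistence
import Literature.Geometry.Symplectic.AttachingFramingProofs
import Literature.Geometry.Symplectic.AttachingCircleProofs
import Literature.Topology.FourManifolds.HandleAttachingMapsExistence
import HarnessLib

/-!
# N3 (`stub_STgeo`) ▸ N3-nat ▸ N3d-3: THE OLD HANDLES RE-PLANTED ON THE STABILISED BASE —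
# `hold k := S.E.liftIdx (h k)` and its link clauses (page, shadow `= embed`, page twisting, off the block
# sector, disjoint ranges) from the clauses of `StabBaseData`
(wave 7, brick H6-10 of stub `stub_STgeo` = node N3 of NF4, line `modp-braid-orbits`, crux
`ConvexBisection.AcyclicBisectionExists`, item stmt-SmoothPoincare4-10508; registered sub-goal
`helper_hold_link`; design file `work/design/N3_Stabilisation_Design.lean` (G5, wave 6), piece N3d-3
`node_rebase` ("`hold k := S.E.jA ∘ h k` (lifts: old ranges miss the model region) … The link clauses of
`hold` from `NormalisedDatum` + `S.flat/shadow_embed/twisting_transport`"); vocabulary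
`…StabilisationData.lean` (H6-1), the mixed-index lift `…MixedIndexLift.lean` (H6-9).)

For stabilised base data `S : StabBaseData g n c` and an old 2-handle attaching map `q` on `Base g` whose
range lies inside `‖x‖² < 4 − ε₁` (the position N3d-0 normalises the old handles to), the range misses the
1-handle ranges of `S` (`disjoint_range_q1`: those have `‖x‖² > 4 − ε₁`, `S.range_q1`), so `q` lifts to the
2-handle attaching map `S.E.liftIdx q _` of `Base (g+1)` (H6-9), and the clauses of `S` transport its
Lefschetz data: attaching circle in the SAME flat page (`S.flat`), shadow `embed g` of the old shadow
(`S.shadow_embed`), the SAME page twisting (`S.twisting_transport`, through the chain rule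
`attachingFraming_liftIdx`: the handle framing of the lifted map is `d(E.jA)` of the old one), range over the
SAME directions (`S.fibred`), and disjoint old maps lift to disjoint maps.  Packaged for the family of a
`NormalisedDatum` as `hold_link` / registered `helper_hold_link`: the four `hold`-clauses of
`TwoSidedStabModel` + pairwise disjointness.  Everything is proved; no definitions.
References: J. B. Etnyre, T. Fuller, IMRN 2006, §2 [EtnyreFuller2006]; A. A. Kosinski, *Differential
Manifolds* (1993), VI §6–7 [Kosinski1993].
-/

noncomputable section

-- the prescribed namespace `Summit.<P>.<Sub>.…` duplicates `SmoothPoincare4` (P = Sub)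
set_option linter.dupNamespace false

open scoped Manifold ContDiff Topology
open Set Function Metric

namespace Summit.SmoothPoincare4.SmoothPoincare4.Theorems.AcyclicBisectionExists.ModpBraidOrbits

open Literature.GroupTheory.CombinatorialGroupTheory.SignedHurwitz
open Literature.Topology.FourManifolds Literature.Topology.FourManifolds.LefschetzBase
open Literature.Topology.FourManifolds.HandleAttachingMap
open Literature.Geometry.Symplectic

/-! ## §1 The handle framing of a lifted 2-handle map (chain rule) -/

namespace MixedIndexLift

universe u

variable {k : ℕ} {M : Type u} [TopologicalSpace M] [T2Space M] [ChartedSpace (EuclideanHalfSpace 4) M]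
  [IsManifold (𝓡∂ 4) ∞ M] {ι : Type*} [Finite ι] {h : ι → HandleAttachingMap 3 k M}
  {P₁ : Type*} [TopologicalSpace P₁] [ChartedSpace (EuclideanHalfSpace 4) P₁] [IsManifold (𝓡∂ 4) ∞ P₁]

/-- **The handle framing of the lifted 2-handle map is the push-forward `d(jA)` of the old handle
framing** (chain rule; the codomain restriction to the open `M ∖ ⋃ h̄ᵢ(S)` does not change manifold
derivatives, `hasMFDerivAt_codRestrict_opens`). [cite: Kirby1989, Ch. I §2] -/
theorem attachingFraming_liftIdx (D : MultiAttachmentData h (𝓡∂ 4) P₁) (g : HandleAttachingMap 3 2 M)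
    (hg : ∀ i, Disjoint (range g.toFun) (range (h i).toFun))
    (θ : Metric.sphere (0 : EuclideanSpace ℝ (Fin 2)) 1) :
    (D.liftIdx g hg).attachingFraming θ =
      mfderiv (𝓡∂ 4) (𝓡∂ 4) D.jA (liftPtIdx g hg (coreTubePt θ)) (g.attachingFraming θ) := by
  have hgd : MDifferentiableAt (𝓡∂ 4) (𝓡∂ 4) g.toFun (coreTubePt θ) :=
    (g.isSmoothEmbedding.contMDiff (coreTubePt θ)).mdifferentiableAt (by simp)
  have hl : HasMFDerivAt (𝓡∂ 4) (𝓡∂ 4) (liftPtIdx g hg) (coreTubePt θ)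
      (mfderiv (𝓡∂ 4) (𝓡∂ 4) g.toFun (coreTubePt θ)) :=
    hasMFDerivAt_codRestrict_opens (fun _ => rfl) hgd.hasMFDerivAt
  have hjA : MDifferentiableAt (𝓡∂ 4) (𝓡∂ 4) D.jA (liftPtIdx g hg (coreTubePt θ)) :=
    (D.hjA.contMDiff _).mdifferentiableAt (by simp)
  unfold HandleAttachingMap.attachingFraming
  show mfderiv (𝓡∂ 4) (𝓡∂ 4) (D.jA ∘ liftPtIdx g hg) (coreTubePt θ) _ = _
  rw [mfderiv_comp (coreTubePt θ) hjA hl.mdifferentiableAt, hl.mfderiv]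
  rfl

end MixedIndexLift

/-! ## §2 One old handle on the stabilised base -/

namespace StabHold

variable {g n : ℕ} {c : Fin g ⊕ Fin g → ℤ} (S : StabBaseData g n c)

/-- **An old 2-handle map inside `‖x‖² < 4 − ε₁` misses the 1-handle ranges of the stabilised base data**
(those lie in `‖x‖² > 4 − ε₁`, `S.range_q1`). [folklore] -/
theorem disjoint_range_q1 (q : HandleAttachingMap 3 2 (Base g))
    (hq : ∀ y, ‖cx (q.toFun y).1‖ ^ 2 < 4 - S.ε₁) (i : Fin 2) :
    Disjoint (range q.toFun) (range (S.q1 i).toFun) := by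
  rw [Set.disjoint_left]
  rintro _ ⟨y, rfl⟩ ⟨y', he⟩
  have h1 := hq y
  have h2 := (S.range_q1 i y').2
  rw [he] at h2
  linarith

/-- Pointwise: no 1-handle range point is a point of the old map. [folklore] -/
theorem q1_ne (q : HandleAttachingMap 3 2 (Base g)) (hq : ∀ y, ‖cx (q.toFun y).1‖ ^ 2 < 4 - S.ε₁)
    (y : ↥(handleTube 3 2)) (i : Fin 2) (y' : ↥(handleTube 3 1)) : (S.q1 i).toFun y' ≠ q.toFun y := fun he =>
  Set.disjoint_left.1 (disjoint_range_q1 S q hq i) (mem_range_self y) (he ▸ mem_range_self y')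

/-- **The lifted old handle: same page.** [cite: EtnyreFuller2006, §2] -/
theorem liftIdx_mem_page (q : HandleAttachingMap 3 2 (Base g)) (hq : ∀ y, ‖cx (q.toFun y).1‖ ^ 2 < 4 - S.ε₁)
    {d : ℂ} (hd : ‖d‖ = 1) (hpage : ∀ θ, q.attachingCircle θ ∈ page g d)
    (θ : Metric.sphere (0 : EuclideanSpace ℝ (Fin 2)) 1) :
    (S.E.liftIdx q (disjoint_range_q1 S q hq)).attachingCircle θ ∈ page (g + 1) d :=
  S.flat d hd _ (fun i y' => q1_ne S q hq (coreTubePt θ) i y') (hpage θ)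

/-- **The lifted old handle: shadow `embed g` of the old shadow** (clause `shadow_embed`).
[cite: EtnyreFuller2006, §2] -/
theorem shadow_liftIdx (q : HandleAttachingMap 3 2 (Base g)) (hq : ∀ y, ‖cx (q.toFun y).1‖ ^ 2 < 4 - S.ε₁)
    {d : ℂ} (hd : ‖d‖ = 1) (hpage : ∀ θ, q.attachingCircle θ ∈ page g d) :
    shadow (g + 1) (S.E.liftIdx q (disjoint_range_q1 S q hq)).attachingCircle
        (S.E.liftIdx q (disjoint_range_q1 S q hq)).continuous_attachingCircle =
      embed g (shadow g q.attachingCircle q.continuous_attachingCircle) := by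
  obtain ⟨hK', e⟩ := S.shadow_embed d hd q.attachingCircle q.continuous_attachingCircle hpage
  exact e

/-- **The lifted old handle: same page twisting** (clause `twisting_transport` + the chain rule
`attachingFraming_liftIdx`). [cite: EtnyreFuller2006, §2] -/
theorem pageTwisting_liftIdx (q : HandleAttachingMap 3 2 (Base g)) (hq : ∀ y, ‖cx (q.toFun y).1‖ ^ 2 < 4 - S.ε₁)
    {d : ℂ} (hd : ‖d‖ = 1) (hpage : ∀ θ, q.attachingCircle θ ∈ page g d) :
    pageTwisting (g + 1) (S.E.liftIdx q (disjoint_range_q1 S q hq)).attachingCircle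
        (S.E.liftIdx q (disjoint_range_q1 S q hq)).attachingFraming =
      pageTwisting g q.attachingCircle q.attachingFraming := by
  have e2 : (S.E.liftIdx q (disjoint_range_q1 S q hq)).attachingFraming = fun θ =>
      mfderiv (𝓡∂ 4) (𝓡∂ 4) S.E.jA ⟨q.attachingCircle θ, S.page_mem d hd _ (hpage θ)⟩ (q.attachingFraming θ) :=
    funext (MixedIndexLift.attachingFraming_liftIdx S.E q (disjoint_range_q1 S q hq))
  rw [e2]
  exact S.twisting_transport d hd q.attachingCircle q.attachingFraming (isSmoothEmbedding_attachingCircle q)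
    hpage (fun θ i y' => q1_ne S q hq (coreTubePt θ) i y') (isKnotFraming_attachingFraming q)

/-- **The lifted old handle: range over the same directions** (clause `fibred`): `w ∘ lifted = w ∘ q`.
[folklore] -/
theorem w_liftIdx (q : HandleAttachingMap 3 2 (Base g)) (hq : ∀ y, ‖cx (q.toFun y).1‖ ^ 2 < 4 - S.ε₁)
    (y : ↥(handleTube 3 2)) :
    w (g + 1) ((S.E.liftIdx q (disjoint_range_q1 S q hq)).toFun y).1 = w g (q.toFun y).1 :=
  S.fibred _ (fun i y' => q1_ne S q hq y i y')

end StabHold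

/-! ## §3 The family of old handles of a normalised datum, re-planted -/

namespace StabHold

variable {g : ℕ} {l : IntWord g} {c : Fin g ⊕ Fin g → ℤ} (S : StabBaseData g l.length c)

/-- **The link clauses of `hold k := S.E.liftIdx (h k)`** (piece N3d-3, `TwoSidedStabModel`): for the old
family `h` of a normalised datum (pairwise disjoint ranges, circles in the pages `pageDir (n+4) (k+4)`,
shadows `(l.get k).1`, twistings by sign, ranges off the block sector and inside `‖x‖² < 4 − ε₁`) the
re-planted family has circles in the same pages, shadows `embed g (l.get k).1`, the same twistings, ranges
off the block sector, and pairwise disjoint ranges. [cite: EtnyreFuller2006, §2] -/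
theorem hold_link (h : Fin l.length → HandleAttachingMap 3 2 (Base g))
    (hdis : Pairwise fun i j => Disjoint (range (h i).toFun) (range (h j).toFun))
    (hpage : ∀ (i : Fin l.length) θ, (h i).attachingCircle θ ∈ page g (pageDir (l.length + 4) (i + 4)))
    (hsh : ∀ i, shadow g (h i).attachingCircle (h i).continuous_attachingCircle = (l.get i).1)
    (htw : ∀ i, pageTwisting g (h i).attachingCircle (h i).attachingFraming = if (l.get i).2 then -1 else 1)
    (hrng : ∀ i y, w g ((h i).toFun y).1 ∉ blockSector l.length ∧ ‖cx ((h i).toFun y).1‖ ^ 2 < 4 - S.ε₁) :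
    ∃ hold : Fin l.length → HandleAttachingMap 3 2 (Base (g + 1)),
      (∀ k, hold k = S.E.liftIdx (h k) (disjoint_range_q1 S (h k) (fun y => (hrng k y).2))) ∧
      (∀ (k : Fin l.length) θ, (hold k).attachingCircle θ ∈ page (g + 1) (pageDir (l.length + 4) (k + 4))) ∧
      (∀ k, shadow (g + 1) (hold k).attachingCircle (hold k).continuous_attachingCircle = embed g (l.get k).1) ∧
      (∀ k, pageTwisting (g + 1) (hold k).attachingCircle (hold k).attachingFraming =
        if (l.get k).2 then -1 else 1) ∧
      (∀ k y, w (g + 1) ((hold k).toFun y).1 ∉ blockSector l.length) ∧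
      (Pairwise fun i j => Disjoint (range (hold i).toFun) (range (hold j).toFun)) := by
  refine ⟨fun k => S.E.liftIdx (h k) (disjoint_range_q1 S (h k) (fun y => (hrng k y).2)), fun k => rfl,
    fun k θ => ?_, fun k => ?_, fun k => ?_, fun k y => ?_, fun i j hij => ?_⟩
  · exact liftIdx_mem_page S (h k) (fun y => (hrng k y).2) (norm_pageDir _ _) (hpage k) θ
  · rw [shadow_liftIdx S (h k) (fun y => (hrng k y).2) (norm_pageDir _ _) (hpage k), hsh k]
  · rw [pageTwisting_liftIdx S (h k) (fun y => (hrng k y).2) (norm_pageDir _ _) (hpage k), htw k]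
  · rw [w_liftIdx S (h k) (fun y => (hrng k y).2) y]; exact (hrng k y).1
  · exact MixedIndexLift.disjoint_range_liftIdx S.E (h i) (h j) _ _ (hdis hij)

end StabHold

/-! ## §4 The handlebody-side family `Sum.elim ![S.qA, S.qB] hold` and the piece `X₁` -/

namespace StabHold

variable {g : ℕ} {l : IntWord g} {c : Fin g ⊕ Fin g → ℤ} (S : StabBaseData g l.length c)

/-- **The handlebody-side family of `TwoSidedStabModel` has pairwise disjoint ranges**: `qA`, `qB` are
disjoint (`S.qAB_disjoint`) with ranges over the block sector (`S.range_qA/qB`), the re-planted old maps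
are pairwise disjoint with ranges OFF the block sector. [folklore] -/
theorem pairwise_disjoint_blockFamily (hold : Fin l.length → HandleAttachingMap 3 2 (Base (g + 1)))
    (hhold : ∀ k y, w (g + 1) ((hold k).toFun y).1 ∉ blockSector l.length)
    (hdis : Pairwise fun i j => Disjoint (range (hold i).toFun) (range (hold j).toFun)) :
    Pairwise fun i j => Disjoint (range (Sum.elim ![S.qA, S.qB] hold i).toFun)
      (range (Sum.elim ![S.qA, S.qB] hold j).toFun) := by
  -- a block map and an old map are disjoint: directions in / off the block sector
  have hAk : ∀ k, Disjoint (range S.qA.toFun) (range (hold k).toFun) := fun k =>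
    Set.disjoint_left.2 fun _ ⟨y, hy⟩ ⟨y', hy'⟩ => hhold k y' (by rw [hy', ← hy]; exact (S.range_qA y).2)
  have hBk : ∀ k, Disjoint (range S.qB.toFun) (range (hold k).toFun) := fun k =>
    Set.disjoint_left.2 fun _ ⟨y, hy⟩ ⟨y', hy'⟩ => hhold k y' (by rw [hy', ← hy]; exact (S.range_qB y).2)
  rintro (a | i) (b | j) hne
  · fin_cases a <;> fin_cases b
    · exact absurd rfl hne
    · simpa using S.qAB_disjoint
    · simpa using S.qAB_disjoint.symm
    · exact absurd rfl hne
  · fin_cases a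
    · simpa using hAk j
    · simpa using hBk j
  · fin_cases b
    · simpa using (hAk i).symm
    · simpa using (hBk i).symm
  · exact hdis fun e => hne (congrArg Sum.inr e)

/-- **The handlebody-side piece `X₁ = Base (g+1) ∪ qA ∪ qB ∪ old⁗` exists** (Kosinski's simultaneous
attachment `exists_isMultiAttachment_holds`), compact, Hausdorff, second countable, with its
multi-attachment DATA. [cite: Kosinski1993, VI §6] -/
theorem exists_X₁ (hold : Fin l.length → HandleAttachingMap 3 2 (Base (g + 1)))
    (hhold : ∀ k y, w (g + 1) ((hold k).toFun y).1 ∉ blockSector l.length)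
    (hdis : Pairwise fun i j => Disjoint (range (hold i).toFun) (range (hold j).toFun)) :
    ∃ (X₁ : Type) (_ : TopologicalSpace X₁) (_ : T2Space X₁) (_ : SecondCountableTopology X₁)
      (_ : CompactSpace X₁) (_ : ChartedSpace (EuclideanHalfSpace 4) X₁) (_ : IsManifold (𝓡∂ 4) ∞ X₁),
      Nonempty (MultiAttachmentData (Sum.elim ![S.qA, S.qB] hold) (𝓡∂ 4) X₁) := by
  obtain ⟨P, _, _, _, hT2, h2nd, hcpt, hP⟩ := exists_isMultiAttachment_holds 3 2 (Base (g + 1))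
    (Fin 2 ⊕ Fin l.length) (Sum.elim ![S.qA, S.qB] hold) (pairwise_disjoint_blockFamily S hold hhold hdis)
  exact ⟨P, inferInstance, hT2, h2nd, hcpt inferInstance, inferInstance, inferInstance,
    hP.nonempty_multiAttachmentData⟩

end StabHold

/-! ## Registered helper -/

/-- **Registered helper `helper_hold_link` (sub-goal of `stub_STgeo` ▸ N3-nat ▸ N3d-3 `hold`, wave 7, lead
c5): the old 2-handles of a normalised datum re-planted on the stabilised base by the mixed-index lift, with
the four `hold`-clauses of `TwoSidedStabModel` and pairwise disjoint ranges.** [cite: EtnyreFuller2006, §2] -/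
theorem helper_hold_link : ∀ (g : ℕ) (l : Literature.GroupTheory.CombinatorialGroupTheory.SignedHurwitz.IntWord g) (c : Fin g ⊕ Fin g → ℤ) (S : Summit.SmoothPoincare4.SmoothPoincare4.Theorems.AcyclicBisectionExists.ModpBraidOrbits.StabBaseData g l.length c) (h : Fin l.length → Literature.Topology.FourManifolds.HandleAttachingMap 3 2 (Literature.Topology.FourManifolds.LefschetzBase.Base g)), (Pairwise fun i j => Disjoint (Set.range (h i).toFun) (Set.range (h j).toFun)) → (∀ (i : Fin l.length) θ, (h i).attachingCircle θ ∈ Literature.Topology.FourManifolds.LefschetzBase.page g (Literature.Topology.FourManifolds.LefschetzBase.pageDir (l.length + 4) (i + 4))) → (∀ i, Literature.Topology.FourManifolds.LefschetzBase.shadow g (h i).attachingCircle (h i).continuous_attachingCircle = (l.get i).1) → (∀ i, Literature.Topology.FourManifolds.LefschetzBase.pageTwisting g (h i).attachingCircle (h i).attachingFraming = if (l.get i).2 then -1 else 1) → (∀ i y, Literature.Topology.FourManifolds.LefschetzBase.w g ((h i).toFun y).1 ∉ Summit.SmoothPoincare4.SmoothPoincare4.Theorems.AcyclicBisectionExists.ModpBraidOrbits.blockSector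 l.length ∧ ‖Literature.Topology.FourManifolds.LefschetzBase.cx ((h i).toFun y).1‖ ^ 2 < 4 - S.ε₁) → ∃ hold : Fin l.length → Literature.Topology.FourManifolds.HandleAttachingMap 3 2 (Literature.Topology.FourManifolds.LefschetzBase.Base (g + 1)), (∀ (k : Fin l.length) θ, (hold k).attachingCircle θ ∈ Literature.Topology.FourManifolds.LefschetzBase.page (g + 1) (Literature.Topology.FourManifolds.LefschetzBase.pageDir (l.length + 4) (k + 4))) ∧ (∀ k, Literature.Topology.FourManifolds.LefschetzBase.shadow (g + 1) (hold k).attachingCircle (hold k).continuous_attachingCircle = Literature.GroupTheory.CombinatorialGroupTheory.SignedHurwitz.embed g (l.get k).1) ∧ (∀ k, Literature.Topology.FourManifolds.LefschetzBase.pageTwisting (g + 1) (hold k).attachingCircle (hold k).attachingFraming = if (l.get k).2 then -1 else 1) ∧ (∀ k y, Literature.Topology.FourManifolds.LefschetzBase.w (g + 1) ((hold k).toFun y).1 ∉ Summit.SmoothPoincare4.SmoothPoincare4.Theorems.AcyclicBisectionExists.ModpBraidOrbits.blockSector l.length) ∧ (Pairwise fun i j => Disjoint (Set.range (hold i).toFun)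 (Set.range (hold j).toFun)) :=
  fun _ _ _ S h hdis hpage hsh htw hrng => by
    obtain ⟨hold, -, h1, h2, h3, h4, h5⟩ := StabHold.hold_link S h hdis hpage hsh htw hrng
    exact ⟨hold, h1, h2, h3, h4, h5⟩

end Summit.SmoothPoincare4.SmoothPoincare4.Theorems.AcyclicBisectionExists.ModpBraidOrbits

end
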